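import Summits.QuantumFields.BalabanUV.T4Continuum.Spine.NE1p.DressedSmallFieldInduction
import Summits.QuantumFields.BalabanUV.T4Continuum.Spine.NE1p.DressedSmallFieldPencilWitness

/-!
# T⁴ programme, spine estimate NE1′ (node O3b/H2) — WITNESS W25: the table-strength induction `DressedSmallFieldInduction` (owner node
# N0m, p220799) RUNS on a DECIDED dressed trajectory — the step-link «next attached table = this attached output» in kernel on W23's
# two-cube catalogue (it holds there BY THE DEFINITION of the toy run, NOT for Bałaban's 𝐕_k), `attachedPart_locE_le` firing at EVERY step,
# `hstep` DERIVED FOR THIS RUN under the bootstrap, the attached sizes K-uniform, geometrically decaying and never zero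

Cell `pub-balaban`, sub-cell `t4`, row NE1′ formalisation crew (`t4/formal/NE1p/LEAVES.md` row W25 ∕ DAG N29zb; INTENT journal l.15360, BOOKED
typer R-T96 (ii) with wording (g)), unit `b2b-balaban-t4-ne1p-formalise-leaf-08` (gen 7).  ADDITIVE — imports N0m `Spine/NE1p/DressedSmallFieldInduction` and this lineage's
W23 `Spine/NE1p/DressedSmallFieldPencilWitness` ONLY (both children of N0j); three toy DATA `def`s (`actR`, `mR`, `traj`) + theorems; 0
`def … : Prop`, 0 cite, 0 sorry.  W23's two-cube catalogue (`Pol`, `cubes₂`, `d₂`, the footprint-overlap relation `polyInc on cubes₂` with its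
instances) and its sockets `hloc₂`∕`hd₂`∕`h126₂`∕`hvol₂`∕`h227₂`∕`hsmall₂`∕`Z₂_eq` are USED BY NAME — nothing of W23 or N0m is restated.

WHY THIS FILE.  N0m types the K-uniformity of the observable-attached sizes along the dressed small-field run as §2 `attachedPart_locE_le`
(ONE step: the attached part of the output is `≤ 4·(e ν c₁ K₀²)·A₁·e^{−r₁ d(X)}`, LINEAR in the attached table's (2.38)-slope `A₁`, along the
TABLE-STRENGTH pencil `s ↦ 𝐕 + s·𝐖` of radius `ϱ ≥ max(2, A₀∕A₁)`) and §3 `attachedSize_reproduces`∕`attachedSize_uniform` ([arith]: sizes with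
`D (k+1) ≤ θ·D k`, `θ ≤ 1`, stay below `D 0`).  The cross-read of record (typer R-T93 (ii), X103 (d)) notes that N0m «has no trajectory object and
no theorem deriving `hstep` from §2 — the step-link is the owner's READING».  This file EXERCISES that link in kernel on a DECIDED run:
* §1 the STEP DATUM on W23's catalogue: activities `actR a₀ a₁ s Z = (a₀ + s·a₁)·e^{−5 d(Z)}` AFFINE in the table strength `s` (undressed
  intercept `a₀`, attached slope `a₁`), majorant `mR a₀ a₁ ϱ Z = (a₀ + ϱ·a₁)·e^{−5 d(Z)}`; sockets (E1) `hhol_R`, (E2) `hm_R`, the AFFINE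
  (2.38)-shape `hL3_R` (toy-true BY CHOICE), `hsmall_of_le` (the one-run clause holds as soon as the affine constant is `≤ 1∕12`, from W23 `hsmall₂`).
* §2 ONE STEP FIRES: `attachedPart_fires` = N0m `attachedPart_locE_le` BY NAME ONCE at `X = {0,1}` with every socket discharged;
  `attachedPart_fires_ratio` = the same at N0m's intercept-to-slope radius `ϱ := max 2 (a₀∕a₁)` — with a LIVE intercept `a₀ > 0` §1's leak
  `a₀∕ϱ ≤ a₁` (`affine_div_le`) is genuinely used; the clause then reads (C1) `a₀ ≤ 1∕24` and `a₀ + 2a₁ ≤ 1∕12`.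
* §3 THE RUN: `traj a₀ C′ D₀ : ℕ → ℝ`, `traj 0 = D₀`, `traj (k+1) = ‖E[𝐕 + 𝐖_k]({0,1}) − E[𝐕]({0,1})‖` where the step-`k` table has slope
  `A₁(k) = C′·traj k` — THE ATTACHED TABLE OF STEP k+1 IS THE ATTACHED OUTPUT OF STEP k BY THE DEFINITION of `traj` (the owner's reading (R9)
  MODELLED on a toy — exercised, not derived, for Bałaban's 𝐕_k).  THE STEP-LINK `traj_succ_le`: under `a₀ + 2·C′·traj k ≤ 1∕12` (the clause READ AT THE CURRENT STEP), §2 fires and N0m `attachedSize_reproduces` BY NAME turns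
  its output into `traj (k+1) ≤ 9·C′·traj k` (θ = 9C′: (2.41)'s `e` is cancelled by the live decay `e^{−r₁ dX} = e⁻¹`, cf. W23 `envelope₂_eq`).
  Because the clause at step `k` reads `traj k`, N0m's UNCONDITIONAL `hstep` is available only under the induction hypothesis `traj k ≤ D₀`:
  `uniform_of_bootstrap` ([arith], the form a decided run CAN feed — print's own order on [Balaban1988RGII] p. 21, where (1.18) at `k` certifies
  «O(1)C₃ε₁ ≤ ½E₀» at `k`; TYPE∕CONTEXT only) gives `traj_le_init : traj k ≤ D₀` under (C1), (C2) `a₀ + 2·C′·D₀ ≤ 1∕12`, (C3) `9·C′ ≤ 1`; THEN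
  `traj_hstep` holds unconditionally and N0m `attachedSize_uniform` fires BY NAME (`traj_uniform`); `traj_geom : traj k ≤ (9C′)^k·D₀`.
* §4 GENUINE: `exp_locE_univ` computes `exp E_v({0,1}) = ((1 + v₀)(1 + v₁) + v₀₁)∕((1 + v₀)(1 + v₁))` for real activities `0 ≤ v` on the
  catalogue (KP's (2)–(3) `polymerLogZ_eq_sum_truncatedWeight`, the three non-covering families `∅, {p0}, {p1}`, `exp_polymerLogZ` ×3, W23 `Z₂_eq`);
  `attached_live`: the attached part at `{0,1}` is NOT zero for `a₁ > 0`, `a₀ + a₁ < 1` (`t ↦ t∕(1+t)²` is injective on `[0,1)`); hence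
  `traj_pos : 0 < traj k` for EVERY `k` — the run never dies while it decays geometrically.
* §5 the located run `a₀ = 1∕24`, `C′ = 1∕18` (θ = ½ — the factor print displays on p. 21, here a kernel consequence of `C′` on a toy, no numeral
  asserted from print), `D₀ = 3∕8` ((C2) with EQUALITY): `run_half : traj k ≤ (1∕2)^k·(3∕8) ∧ 0 < traj k`.
Planted mutants (NOT filed; `HOME/b2b-balaban-t4-ne1p-formalise-leaf-08/g7/Mutants_W25.NOT-TO-FILE.lean`, rc 1): `C′ := 1∕6` at §5 (θ = 3∕2:
(C3) and (C2) fail), `a₀ := 1∕8` at §5 ((C1) fails), the radius frozen at `ϱ := 2` in §2 with `a₀ > 2a₁` (`hϱA` fails).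

HONEST FRAMING.  A DECIDED TOY RUN inhabits N0m's hypothesis SHAPES and exercises the step-link; 0 binders instantiated on Bałaban's densities,
(2.14) data, localization domains, minimisers, backgrounds or value maps; (B1) `hrep`, (B3) `hL3` (= GAPS G-ne9p2-5, UNPRINTED; toy-true here BY
CHOICE of `mR`), (B5) against print's numbers are untouched; the identification «next table = this output» is the READING (R9) run on a toy, not
derived for Bałaban's 𝐕_k(μ); discharges no wall item; R-t4r2-Q2 NOT met thereby; NE1′ ⇐ the named binders — NOT proved, NOT printed; spine PROVED 0∕9; count 9 unchanged.  Rung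
(B)+1 on ONE finite four-torus — NOT infinite volume, NOT a mass gap, NOT OS on ℝ⁴, NOT Clay.  HONEST DEPENDENCY: continuum YM on T⁴ ⇐ BetaPertH ∧
nine spine estimates (0/9 proved); BetaPertH ⇐ (D1) ∧ (D4) ∧ CAP+tail; G-an2-4 gates asym, D1 and NE2/3/4.
-/

noncomputable section

namespace Summit.QuantumFields.BalabanUV.T4Continuum.NE1p.DressedSmallFieldInductionWitness

open Finset Metric Complex
open scoped Function
open Literature.MathematicalPhysics.QuantumFieldTheory.Balaban1983to89.B13Resummation (locE)
open Literature.Probability.LatticeModels (polyInc polymerPartitionFunction polymerPartitionFunction_insert polymerPartitionFunction_empty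
  polymerLogZ truncatedWeight polymerLogZ_eq_sum_truncatedWeight exp_polymerLogZ truncatedWeight_empty polymerLogZ_empty)
open Summit.QuantumFields.BalabanUV.T4Continuum.NE1p.DressedSmallFieldInduction
open Summit.QuantumFields.BalabanUV.T4Continuum.NE1p.DressedSmallFieldPencilWitness
open DressedSmallFieldPencilWitness.Pol

/-! ## §1 THE STEP DATUM: activities affine in the table strength on W23's two-cube catalogue -/

/-- The dressed activities of ONE step along the TABLE-STRENGTH pencil `s ↦ 𝐕 + s·𝐖` on W23's two-cube catalogue: `act s Z = (a₀ + s·a₁)·e^{−5 d(Z)}`,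
undressed intercept `a₀`, attached slope `a₁` (entire in `s`). -/
def actR (a₀ a₁ : ℝ) (s : ℂ) (Z : Pol) : ℂ := ((a₀ : ℂ) + s * (a₁ : ℂ)) * (Real.exp (-(5 * d₂ Z)) : ℂ)

/-- The strength-free majorant at pencil radius `ϱ`: `m Z = (a₀ + ϱ·a₁)·e^{−5 d(Z)}` — the (2.38)-SHAPE with a constant AFFINE in the radius. -/
def mR (a₀ a₁ ϱ : ℝ) (Z : Pol) : ℝ := (a₀ + ϱ * a₁) * Real.exp (-(5 * d₂ Z))

/-- Socket (E1) `hhol` of N0m §2 on the step datum: the activities are entire in the table strength, a fortiori differentiable on the pencil disc. -/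
theorem hhol_R (a₀ a₁ ϱ : ℝ) : ∀ Z : Pol, cubes₂ Z ⊆ univ → DifferentiableOn ℂ (fun s => actR a₀ a₁ s Z) (ball (0 : ℂ) ϱ) :=
  fun _ _ => (by unfold actR; fun_prop : Differentiable ℂ _).differentiableOn

/-- The size of the activities on the pencil disc: `‖act s Z‖ ≤ (a₀ + ϱ·a₁)·e^{−5 d(Z)} = m Z` for `‖s‖ ≤ ϱ`, `0 ≤ a₀`, `0 ≤ a₁`. -/
theorem norm_actR_le {a₀ a₁ ϱ : ℝ} (ha₀ : 0 ≤ a₀) (ha₁ : 0 ≤ a₁) {s : ℂ} (hs : ‖s‖ ≤ ϱ) (Z : Pol) : ‖actR a₀ a₁ s Z‖ ≤ mR a₀ a₁ ϱ Z := by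
  unfold actR mR
  rw [norm_mul, Complex.norm_real, Real.norm_of_nonneg (Real.exp_nonneg _)]
  refine mul_le_mul_of_nonneg_right ?_ (Real.exp_nonneg _)
  calc ‖(a₀ : ℂ) + s * (a₁ : ℂ)‖ ≤ ‖(a₀ : ℂ)‖ + ‖s * (a₁ : ℂ)‖ := norm_add_le _ _
    _ = a₀ + ‖s‖ * a₁ := by rw [norm_mul, Complex.norm_real, Complex.norm_real, Real.norm_of_nonneg ha₀, Real.norm_of_nonneg ha₁]
    _ ≤ a₀ + ϱ * a₁ := by gcongr

/-- Socket (E2) `hm` of N0m §2 on the step datum: `‖act s Z‖ ≤ m Z` on the pencil disc `‖s‖ < ϱ`. -/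
theorem hm_R {a₀ a₁ ϱ : ℝ} (ha₀ : 0 ≤ a₀) (ha₁ : 0 ≤ a₁) :
    ∀ s ∈ ball (0 : ℂ) ϱ, ∀ Z : Pol, cubes₂ Z ⊆ univ → ‖actR a₀ a₁ s Z‖ ≤ mR a₀ a₁ ϱ Z := fun s hs Z _ => by
  rw [mem_ball_zero_iff] at hs; exact norm_actR_le ha₀ ha₁ hs.le Z

/-- Socket `hL3` of N0m §2 — the AFFINE (2.38)-SHAPE `m Z ≤ (A₀ + ϱ·A₁)·e^{−R d(Z)}` at `R = 5`, with EQUALITY; toy-true BECAUSE `mR` is chosen so, NOT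
(2.38) for any dressed activity of Bałaban's (the dressed instance is the binder (B3) = GAPS G-ne9p2-5). -/
theorem hL3_R (a₀ a₁ ϱ : ℝ) : ∀ Z : Pol, cubes₂ Z ⊆ univ → mR a₀ a₁ ϱ Z ≤ (a₀ + ϱ * a₁) * Real.exp (-(5 * d₂ Z)) := fun _ _ => le_rfl

/-- Socket `hsmall` at W23's letters (`b = 1`, `K₀ = 3∕2`, `ν = c₁ = 1`) for ANY affine constant `A ≤ 1∕12`: `A·e²·(3∕2) ≤ 1` (W23 `hsmall₂` is the
case `A = 1∕12`, i.e. `e² ≤ 8`). -/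
theorem hsmall_of_le {A : ℝ} (hA : A ≤ 1 / 12) : A * Real.exp (1 + 1) * (3 / 2) * 1 * 1 ≤ 1 := by
  have h := hsmall₂
  have hm := mul_le_mul_of_nonneg_right hA (Real.exp_pos (1 + 1 : ℝ)).le
  linarith

/-! ## §2 ONE STEP FIRES: N0m `attachedPart_locE_le` on the step datum, and at the intercept-to-slope radius -/

/-- **N0m §2 `attachedPart_locE_le` FIRES ON THE STEP DATUM** (ONE application BY NAME; W23's sockets `hloc₂`∕`hd₂`∕`h126₂`∕`hvol₂`∕`h227₂` by name,
§1's (E1)∕(E2)∕`hL3`∕clause; the face's conclusion LITERALLY at the catalogue's letters `ν = c₁ = 1`, `K₀ = 3∕2`, `r₁ = dX = 1`): for a pencil radius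
`2 ≤ ϱ` with `a₀ ≤ ϱ·a₁` and the affine constant `a₀ + ϱ·a₁ ≤ 1∕12`,
`‖E[𝐕 + 𝐖]({0,1}) − E[𝐕]({0,1})‖ ≤ 4·(e·1·1·(3∕2)²)·a₁·e^{−1·1}` — LINEAR IN THE SLOPE. -/
theorem attachedPart_fires {a₀ a₁ ϱ : ℝ} (ha₀ : 0 ≤ a₀) (ha₁ : 0 ≤ a₁) (hϱ : 2 ≤ ϱ) (hϱA : a₀ ≤ ϱ * a₁) (hsm : a₀ + ϱ * a₁ ≤ 1 / 12) :
    ‖locE (polyInc on cubes₂) cubes₂ (actR a₀ a₁ 1) univ - locE (polyInc on cubes₂) cubes₂ (actR a₀ a₁ 0) univ‖ ≤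
      4 * (Real.exp 1 * 1 * 1 * (3 / 2) ^ 2) * a₁ * Real.exp (-(1 * 1)) :=
  attachedPart_locE_le (polyInc on cubes₂) (reach := cubes₂) (d := d₂) (m := mR a₀ a₁ ϱ) (act := actR a₀ a₁) (A₀ := a₀) (A₁ := a₁) (R := 5)
    (r₁ := 1) (κ₀ := 1) (K₀ := 3 / 2) (c₁ := 1) (c := 1) (b := 1) (ν := 1) (dX := 1) (ϱ := ϱ) (X := univ) hloc₂ (fun Z => by rw [one_mul]) hd₂
    ha₀ ha₁ (by norm_num) (by norm_num) (by norm_num) (by norm_num) (by norm_num) (by norm_num) (by norm_num) h126₂ hvol₂ h227₂ (by norm_num)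
    (hsmall_of_le hsm) univ_nonempty (hhol_R a₀ a₁ ϱ) (hm_R ha₀ ha₁) (hL3_R a₀ a₁ ϱ) hϱ hϱA

/-- **THE SAME AT N0m's INTERCEPT-TO-SLOPE RADIUS `ϱ := max 2 (a₀∕a₁)`** (slope `a₁ > 0`): the radius binders `hϱ`∕`hϱA` are discharged by the
choice (with a LIVE intercept `a₀ > 0` the leak `a₀∕ϱ ≤ a₁` of N0m §1 `affine_div_le` is genuinely at work), and the clause at the affine constant
`a₀ + ϱ·a₁ = a₀ + max(2a₁, a₀)` reads: (C1) `a₀ ≤ 1∕24` and `a₀ + 2·a₁ ≤ 1∕12`. -/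
theorem attachedPart_fires_ratio {a₀ a₁ : ℝ} (ha₀ : 0 ≤ a₀) (ha₁ : 0 < a₁) (h1 : a₀ ≤ 1 / 24) (h2 : a₀ + 2 * a₁ ≤ 1 / 12) :
    ‖locE (polyInc on cubes₂) cubes₂ (actR a₀ a₁ 1) univ - locE (polyInc on cubes₂) cubes₂ (actR a₀ a₁ 0) univ‖ ≤
      4 * (Real.exp 1 * 1 * 1 * (3 / 2) ^ 2) * a₁ * Real.exp (-(1 * 1)) := by
  have hdiv : a₀ / a₁ * a₁ = a₀ := div_mul_cancel₀ a₀ ha₁.ne'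
  refine attachedPart_fires (ϱ := max 2 (a₀ / a₁)) ha₀ ha₁.le (le_max_left _ _) ?_ ?_
  · calc a₀ = a₀ / a₁ * a₁ := hdiv.symm
      _ ≤ max 2 (a₀ / a₁) * a₁ := mul_le_mul_of_nonneg_right (le_max_right _ _) ha₁.le
  · rcases le_total 2 (a₀ / a₁) with h | h
    · rw [max_eq_right h, hdiv]; linarith
    · rw [max_eq_left h]; linarith

/-! ## §3 THE RUN: the attached table of step k+1 IS the attached output of step k -/

/-- **THE DECIDED DRESSED TRAJECTORY** `traj a₀ C′ D₀ : ℕ → ℝ` of attached sizes: `traj 0 = D₀` and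
`traj (k+1) = ‖E[𝐕 + 𝐖_k]({0,1}) − E[𝐕]({0,1})‖`, the step-`k` activities being `actR a₀ (C′·traj k)` — undressed intercept `a₀` at every step, the
attached table's (2.38)-slope `C′` times the CURRENT attached size (`C′` = the (2.38)-constant per unit of attached size, printed TYPE `C₃ε₁∕E₀`):
the reading «next attached table = this attached output» (R9) as a recursion on a toy. -/
def traj (a₀ C' D₀ : ℝ) : ℕ → ℝ
  | 0 => D₀
  | k + 1 => ‖locE (polyInc on cubes₂) cubes₂ (actR a₀ (C' * traj a₀ C' D₀ k) 1) univ -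
      locE (polyInc on cubes₂) cubes₂ (actR a₀ (C' * traj a₀ C' D₀ k) 0) univ‖

/-- The run starts at `D₀`. -/
theorem traj_zero (a₀ C' D₀ : ℝ) : traj a₀ C' D₀ 0 = D₀ := rfl
/-- The successor size is the norm of the attached part of the step's output at `X = {0,1}`. -/
theorem traj_succ (a₀ C' D₀ : ℝ) (k : ℕ) : traj a₀ C' D₀ (k + 1) =
    ‖locE (polyInc on cubes₂) cubes₂ (actR a₀ (C' * traj a₀ C' D₀ k) 1) univ - locE (polyInc on cubes₂) cubes₂ (actR a₀ (C' * traj a₀ C' D₀ k) 0) univ‖ := rfl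

/-- The attached sizes are nonnegative. -/
theorem traj_nonneg {a₀ C' D₀ : ℝ} (hD₀ : 0 ≤ D₀) : ∀ k, 0 ≤ traj a₀ C' D₀ k
  | 0 => hD₀
  | _ + 1 => norm_nonneg _

/-- With slope `0` the pencil is constant: no attached table, no attached part. -/
theorem actR_slope_zero (a₀ : ℝ) (s : ℂ) : actR a₀ 0 s = actR a₀ 0 0 := by
  funext Z; simp [actR]

/-- **N0m's STEP-LINK EXERCISED IN KERNEL ON THE TOY RUN.**  If the clause holds AT THE CURRENT STEP — `a₀ + 2·C′·traj k ≤ 1∕12`, read at the current attached size — then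
§2 fires at slope `A₁ = C′·traj k` (N0m `attachedPart_locE_le` BY NAME, intercept-to-slope radius) and N0m §3 `attachedSize_reproduces` BY NAME (its
`hE` = §2's literal output, `hclause` with EQUALITY at `θ₁ = 9e·C′`) turns the output into `traj (k+1) ≤ 9·C′·traj k` (the decay `e⁻¹` folded:
θ = 9C′).  At slope `0` the pencil is constant and both sides vanish. -/
theorem traj_succ_le {a₀ C' D₀ : ℝ} (ha₀ : 0 ≤ a₀) (hC : 0 ≤ C') (hD₀ : 0 ≤ D₀) (h1 : a₀ ≤ 1 / 24) (k : ℕ)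
    (hk : a₀ + 2 * C' * traj a₀ C' D₀ k ≤ 1 / 12) : traj a₀ C' D₀ (k + 1) ≤ 9 * C' * traj a₀ C' D₀ k := by
  have hA₁ : 0 ≤ C' * traj a₀ C' D₀ k := mul_nonneg hC (traj_nonneg hD₀ k)
  rcases hA₁.eq_or_lt with h0 | hpos
  · rw [traj_succ, ← h0, actR_slope_zero a₀ 1, sub_self, norm_zero, mul_assoc, ← h0, mul_zero]
  · have hE := attachedPart_fires_ratio ha₀ hpos h1 (by linarith)
    have h := attachedSize_reproduces (E := traj a₀ C' D₀ (k + 1)) (ν := 1) (c₁ := 1) (K₀ := 3 / 2) (C' := C') (D₀ := traj a₀ C' D₀ k)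
      (θ := 9 * Real.exp 1 * C') (r₁ := 1) (dX := 1) (by rw [traj_succ]; exact hE) (traj_nonneg hD₀ k) (le_of_eq (by ring))
    have he : Real.exp 1 * Real.exp (-(1 * 1)) = 1 := by rw [← Real.exp_add]; norm_num
    calc traj a₀ C' D₀ (k + 1) ≤ 9 * Real.exp 1 * C' * traj a₀ C' D₀ k * Real.exp (-(1 * 1)) := h
      _ = 9 * C' * traj a₀ C' D₀ k * (Real.exp 1 * Real.exp (-(1 * 1))) := by ring
      _ = 9 * C' * traj a₀ C' D₀ k := by rw [he, mul_one]

/-- **THE BOOTSTRAP FORM OF N0m's `attachedSize_uniform`** [arith] — the form a decided run CAN feed: if the one-step reproduction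
`D (k+1) ≤ θ·D k` is available UNDER THE INDUCTION HYPOTHESIS `D k ≤ D 0` (because the clause at step `k` reads the current size), `θ ≤ 1` and the
sizes are nonnegative, then `D k ≤ D 0` for every `k`.  (Print's order on [Balaban1988RGII] p. 21: (1.18) at `k` certifies «O(1)C₃ε₁ ≤ ½E₀» at `k`
— TYPE∕CONTEXT; an interface remark for N0m, whose `hstep` is unconditional.) -/
theorem uniform_of_bootstrap {D : ℕ → ℝ} {θ : ℝ} (hθ1 : θ ≤ 1) (hD : ∀ k, 0 ≤ D k) (hboot : ∀ k, D k ≤ D 0 → D (k + 1) ≤ θ * D k) :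
    ∀ k, D k ≤ D 0 := by
  intro k
  induction k with
  | zero => exact le_rfl
  | succ k ih => exact (hboot k ih).trans ((mul_le_of_le_one_left (hD k) hθ1).trans ih)

/-- **K-UNIFORMITY OF THE RUN** under the three DISPLAYED clauses (C1) `a₀ ≤ 1∕24`, (C2) `a₀ + 2·C′·D₀ ≤ 1∕12`, (C3) `9·C′ ≤ 1` (K-free, μ-free
constants): `traj k ≤ D₀` for EVERY `k` — the bootstrap fed by the step-link. -/
theorem traj_le_init {a₀ C' D₀ : ℝ} (ha₀ : 0 ≤ a₀) (hC : 0 ≤ C') (hD₀ : 0 ≤ D₀) (h1 : a₀ ≤ 1 / 24) (h2 : a₀ + 2 * C' * D₀ ≤ 1 / 12)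
    (h3 : 9 * C' ≤ 1) : ∀ k, traj a₀ C' D₀ k ≤ D₀ :=
  uniform_of_bootstrap (D := traj a₀ C' D₀) h3 (traj_nonneg hD₀) fun k hk =>
    traj_succ_le ha₀ hC hD₀ h1 k (by have := mul_le_mul_of_nonneg_left hk (by positivity : (0 : ℝ) ≤ 2 * C'); rw [traj_zero] at this; linarith)

/-- **`hstep` DERIVED FOR THIS DECIDED RUN, UNCONDITIONALLY**: along the toy run the attached sizes reproduce with the factor `θ = 9·C′` at EVERY
step — N0m §3's hypothesis `hstep` is a theorem OF THE TOY (by the definition of `traj`; the clause at step `k` certified by `traj_le_init`);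
nothing is derived for Bałaban's 𝐕_k. -/
theorem traj_hstep {a₀ C' D₀ : ℝ} (ha₀ : 0 ≤ a₀) (hC : 0 ≤ C') (hD₀ : 0 ≤ D₀) (h1 : a₀ ≤ 1 / 24) (h2 : a₀ + 2 * C' * D₀ ≤ 1 / 12)
    (h3 : 9 * C' ≤ 1) : ∀ k, traj a₀ C' D₀ (k + 1) ≤ 9 * C' * traj a₀ C' D₀ k := fun k =>
  traj_succ_le ha₀ hC hD₀ h1 k (by
    have := mul_le_mul_of_nonneg_left (traj_le_init ha₀ hC hD₀ h1 h2 h3 k) (by positivity : (0 : ℝ) ≤ 2 * C'); linarith)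

/-- **N0m §3 `attachedSize_uniform` FIRES ON THE RUN** (BY NAME, once; `hstep := traj_hstep`): `traj k ≤ traj 0` for every `k`. -/
theorem traj_uniform {a₀ C' D₀ : ℝ} (ha₀ : 0 ≤ a₀) (hC : 0 ≤ C') (hD₀ : 0 ≤ D₀) (h1 : a₀ ≤ 1 / 24) (h2 : a₀ + 2 * C' * D₀ ≤ 1 / 12)
    (h3 : 9 * C' ≤ 1) : ∀ k, traj a₀ C' D₀ k ≤ traj a₀ C' D₀ 0 :=
  attachedSize_uniform h3 (traj_nonneg hD₀) (traj_hstep ha₀ hC hD₀ h1 h2 h3)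

/-- **GEOMETRIC DECAY OF THE ATTACHED SIZES**: `traj k ≤ (9C′)^k·D₀` — K-uniform AND summable along the run. -/
theorem traj_geom {a₀ C' D₀ : ℝ} (ha₀ : 0 ≤ a₀) (hC : 0 ≤ C') (hD₀ : 0 ≤ D₀) (h1 : a₀ ≤ 1 / 24) (h2 : a₀ + 2 * C' * D₀ ≤ 1 / 12)
    (h3 : 9 * C' ≤ 1) : ∀ k, traj a₀ C' D₀ k ≤ (9 * C') ^ k * D₀ := by
  intro k
  induction k with
  | zero => rw [pow_zero, one_mul, traj_zero]
  | succ k ih =>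
    calc traj a₀ C' D₀ (k + 1) ≤ 9 * C' * traj a₀ C' D₀ k := traj_hstep ha₀ hC hD₀ h1 h2 h3 k
      _ ≤ 9 * C' * ((9 * C') ^ k * D₀) := mul_le_mul_of_nonneg_left ih (by positivity)
      _ = (9 * C') ^ (k + 1) * D₀ := by ring

/-! ## §4 GENUINE: the attached part at `{0,1}` is NOT zero — the run never dies -/

/-- The families of the two-cube catalogue whose footprints do NOT cover `{0,1}`: `∅`, `{p0}`, `{p1}`. -/
theorem filter_not_cover : (univ : Finset Pol).powerset.filter (fun D => ¬ D.biUnion cubes₂ = univ) = {∅, {p0}, {p1}} := by decide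

/-- **B13's (2.13) AT THE FULL UNION, IN CLOSED FORM ON THE CATALOGUE**: `E_w({0,1}) = log Z(univ) − log Z({p0}) − log Z({p1})` — KP's (2) `log Z = Σ_C Φ^T(C)`
(`polymerLogZ_eq_sum_truncatedWeight`) minus the three non-covering families (`Φ^T(∅) = 0`, `Φ^T({γ}) = log Z({γ})`). -/
theorem locE_univ_eq (w : Pol → ℂ) : locE (polyInc on cubes₂) cubes₂ w univ =
    polymerLogZ (polyInc on cubes₂) w univ - polymerLogZ (polyInc on cubes₂) w {p0} - polymerLogZ (polyInc on cubes₂) w {p1} := by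
  have hsing : ∀ γ : Pol, truncatedWeight (polyInc on cubes₂) w {γ} = polymerLogZ (polyInc on cubes₂) w {γ} := fun γ => by
    unfold truncatedWeight
    have hp : ({γ} : Finset Pol).powerset = {∅, {γ}} := by
      ext s; rw [mem_powerset, subset_singleton_iff, mem_insert, mem_singleton]
    rw [hp, sum_insert (by simp), sum_singleton, polymerLogZ_empty]; simp
  have hsplit := sum_filter_add_sum_filter_not (univ : Finset Pol).powerset (fun D => D.biUnion cubes₂ = univ)
    (fun C => truncatedWeight (polyInc on cubes₂) w C)
  rw [← polymerLogZ_eq_sum_truncatedWeight, filter_not_cover, sum_insert (by decide), sum_pair (by decide), truncatedWeight_empty, hsing,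
    hsing] at hsplit
  have hloc : locE (polyInc on cubes₂) cubes₂ w univ = ∑ C ∈ (univ : Finset Pol).powerset.filter (fun D => D.biUnion cubes₂ = univ),
      truncatedWeight (polyInc on cubes₂) w C := rfl
  rw [hloc]; linear_combination hsplit

/-- The one-polymer partition functions of the catalogue: `Z({γ}; w) = 1 + w γ`. -/
theorem Z_single (w : Pol → ℂ) (γ : Pol) : polymerPartitionFunction (polyInc on cubes₂) w {γ} = 1 + w γ := by
  have hs : ∀ a b : Pol, (polyInc on cubes₂) a b → (polyInc on cubes₂) b a := by decide
  rw [← insert_empty, polymerPartitionFunction_insert hs w (Finset.notMem_empty γ)]; simp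

/-- **`exp E_v({0,1})` IN CLOSED FORM FOR REAL NONNEGATIVE ACTIVITIES**: `exp E_v({0,1}) = ((1 + v p0)(1 + v p1) + v p01)∕((1 + v p0)(1 + v p1))`
(`exp_polymerLogZ` on the three volumes — their partition functions along the rays `t·v` are POSITIVE REALS — and W23 `Z₂_eq`). -/
theorem exp_locE_univ {v : Pol → ℝ} (hv : ∀ Z, 0 ≤ v Z) :
    Complex.exp (locE (polyInc on cubes₂) cubes₂ (fun Z => (v Z : ℂ)) univ) =
      ((((1 + v p0) * (1 + v p1) + v p01) / ((1 + v p0) * (1 + v p1)) : ℝ) : ℂ) := by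
  have hZγ : ∀ γ : Pol, ∀ t ∈ Set.Icc (0 : ℝ) 1, polymerPartitionFunction (polyInc on cubes₂) (fun Z => (t : ℂ) * (v Z : ℂ)) {γ} ≠ 0 := by
    intro γ t ht
    rw [Z_single]
    have e : (1 : ℂ) + (t : ℂ) * (v γ : ℂ) = ((1 + t * v γ : ℝ) : ℂ) := by push_cast; ring
    rw [e, Complex.ofReal_ne_zero]; nlinarith [ht.1, hv γ]
  have hZu : ∀ t ∈ Set.Icc (0 : ℝ) 1, polymerPartitionFunction (polyInc on cubes₂) (fun Z => (t : ℂ) * (v Z : ℂ)) univ ≠ 0 := by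
    intro t ht
    rw [Z₂_eq]
    have e : (1 : ℂ) + (t : ℂ) * (v p01 : ℂ) + (t : ℂ) * (v p1 : ℂ) + (t : ℂ) * (v p0 : ℂ) * (1 + (t : ℂ) * (v p1 : ℂ)) =
        ((1 + t * v p01 + t * v p1 + t * v p0 * (1 + t * v p1) : ℝ) : ℂ) := by push_cast; ring
    rw [e, Complex.ofReal_ne_zero]
    have h0 := hv p0; have h1 := hv p1; have h01 := hv p01; have ht0 := ht.1
    positivity
  rw [locE_univ_eq, Complex.exp_sub, Complex.exp_sub, exp_polymerLogZ hZu, exp_polymerLogZ (hZγ p0), exp_polymerLogZ (hZγ p1), Z₂_eq,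
    Z_single, Z_single]
  have hne0 : (1 : ℂ) + (v p0 : ℂ) ≠ 0 := by rw [← Complex.ofReal_one, ← Complex.ofReal_add, Complex.ofReal_ne_zero]; linarith [hv p0]
  have hne1 : (1 : ℂ) + (v p1 : ℂ) ≠ 0 := by rw [← Complex.ofReal_one, ← Complex.ofReal_add, Complex.ofReal_ne_zero]; linarith [hv p1]
  push_cast
  field_simp
  ring

/-- The step activities at full strength and at strength zero are REAL: `act 1 Z = (a₀ + a₁)·e^{−5d(Z)}`, `act 0 Z = a₀·e^{−5d(Z)}`. -/
theorem actR_one_zero (a₀ a₁ : ℝ) :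
    actR a₀ a₁ 1 = (fun Z => (((a₀ + a₁) * Real.exp (-(5 * d₂ Z)) : ℝ) : ℂ)) ∧ actR a₀ a₁ 0 = (fun Z => ((a₀ * Real.exp (-(5 * d₂ Z)) : ℝ) : ℂ)) := by
  constructor <;> funext Z <;> simp [actR]

/-- **GENUINE — THE ATTACHED PART IS NOT ZERO.**  For `0 ≤ a₀`, `0 < a₁`, `a₀ + a₁ < 1`: `E[𝐕 + 𝐖]({0,1}) ≠ E[𝐕]({0,1})` on the two-cube catalogue —
by `exp_locE_univ` equality would force `t₁∕(1+t₁)² = t₀∕(1+t₀)²` for `t₀ = a₀ < t₁ = a₀ + a₁ < 1`, i.e. `(t₁ − t₀)(1 − t₀t₁) = 0`. -/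
theorem attached_live {a₀ a₁ : ℝ} (ha₀ : 0 ≤ a₀) (ha₁ : 0 < a₁) (hlt : a₀ + a₁ < 1) :
    locE (polyInc on cubes₂) cubes₂ (actR a₀ a₁ 1) univ ≠ locE (polyInc on cubes₂) cubes₂ (actR a₀ a₁ 0) univ := by
  intro heq
  obtain ⟨h1, h0⟩ := actR_one_zero a₀ a₁
  have hv1 : ∀ Z : Pol, 0 ≤ (a₀ + a₁) * Real.exp (-(5 * d₂ Z)) := fun Z => by positivity
  have hv0 : ∀ Z : Pol, 0 ≤ a₀ * Real.exp (-(5 * d₂ Z)) := fun Z => by positivity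
  have key := congrArg Complex.exp heq
  rw [h1, h0, exp_locE_univ hv1, exp_locE_univ hv0, Complex.ofReal_inj] at key
  simp only [d₂, mul_zero, neg_zero, Real.exp_zero, mul_one] at key
  set ε : ℝ := Real.exp (-5) with hε
  have hεpos : 0 < ε := Real.exp_pos _
  have hd1 : (1 + (a₀ + a₁)) * (1 + (a₀ + a₁)) ≠ 0 := by positivity
  have hd0 : (1 + a₀) * (1 + a₀) ≠ 0 := by positivity
  rw [div_eq_div_iff hd1 hd0] at key
  have hprod : ε * a₁ * (1 - a₀ * (a₀ + a₁)) = 0 := by linear_combination key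
  have hpos : 0 < ε * a₁ * (1 - a₀ * (a₀ + a₁)) := mul_pos (mul_pos hεpos ha₁) (by nlinarith)
  exact hpos.ne' hprod

/-- **THE RUN NEVER DIES**: with `0 < C′`, `0 < D₀` and the clauses (C1)–(C3), `0 < traj k` for EVERY `k` — each step's attached table is live
(`traj_le_init` keeps `a₀ + C′·traj k < 1`), so `attached_live` applies at every step. -/
theorem traj_pos {a₀ C' D₀ : ℝ} (ha₀ : 0 ≤ a₀) (hC : 0 < C') (hD₀ : 0 < D₀) (h1 : a₀ ≤ 1 / 24) (h2 : a₀ + 2 * C' * D₀ ≤ 1 / 12)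
    (h3 : 9 * C' ≤ 1) : ∀ k, 0 < traj a₀ C' D₀ k := by
  intro k
  induction k with
  | zero => exact hD₀
  | succ k ih =>
    rw [traj_succ]
    have hA₁ : 0 < C' * traj a₀ C' D₀ k := mul_pos hC ih
    have hbd : C' * traj a₀ C' D₀ k ≤ C' * D₀ := mul_le_mul_of_nonneg_left (traj_le_init ha₀ hC.le hD₀.le h1 h2 h3 k) hC.le
    exact norm_pos_iff.2 (sub_ne_zero.2 (attached_live ha₀ hA₁ (by nlinarith)))

/-! ## §5 THE LOCATED RUN: `a₀ = 1∕24`, `C′ = 1∕18` (θ = ½), `D₀ = 3∕8` ((C2) with equality) -/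

/-- **THE LOCATED RUN**: undressed intercept `a₀ = 1∕24` (LIVE), slope-per-size `C′ = 1∕18` so that `θ = 9C′ = ½`, initial attached size `D₀ = 3∕8`
((C2): `1∕24 + 2·(1∕18)·(3∕8) = 1∕12` — EQUALITY): the attached sizes obey `traj k ≤ (1∕2)^k·(3∕8)` and stay POSITIVE for every `k`. -/
theorem run_half (k : ℕ) : traj (1 / 24) (1 / 18) (3 / 8) k ≤ (1 / 2) ^ k * (3 / 8) ∧ 0 < traj (1 / 24) (1 / 18) (3 / 8) k := by
  refine ⟨?_, traj_pos (by norm_num) (by norm_num) (by norm_num) (by norm_num) (by norm_num) (by norm_num) k⟩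
  have h := traj_geom (a₀ := 1 / 24) (C' := 1 / 18) (D₀ := 3 / 8) (by norm_num) (by norm_num) (by norm_num) (by norm_num) (by norm_num) (by norm_num) k; norm_num at h ⊢; exact h

/-- The located run through N0m's own face: `traj k ≤ traj 0 = 3∕8` by `attachedSize_uniform` BY NAME (`traj_uniform`). -/
theorem run_half_uniform (k : ℕ) : traj (1 / 24) (1 / 18) (3 / 8) k ≤ 3 / 8 := traj_uniform (by norm_num) (by norm_num) (by norm_num) (by norm_num) (by norm_num) (by norm_num) k

end Summit.QuantumFields.BalabanUV.T4Continuum.NE1p.DressedSmallFieldInductionWitness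

end
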